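import Literature.NumberTheory.Automorphic.AutomorphicAnalyticVectorsSpan
import Literature.AlgebraicGeometry.ShimuraVarieties.UnitaryBallCartanDecomposition
import HarnessLib

/-!
# Holomorphic (`𝔭⁻`-null) `K`-finite vectors on `U(2,1)` have analytic `L²`-orbits

Topic `NumberTheory/Automorphic`; the `U(2,1)`-instance of `AutomorphicAnalyticVectorsGeneral`
(Nelson analyticity for a general automorphy datum) through the Cartan frame of
`Literature.AlgebraicGeometry.ShimuraVarieties.BallForms.exists_compactLie_frame`
(`𝔲(2,1) = 𝔨 ⊕ 𝔭`, `[𝔭, 𝔭] ⊆ 𝔨`). The statements are DATUM-FREE: they concern an arbitrary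
adelic group datum `𝒢`, an automorphic measure `μ` on its automorphic quotient, and an arbitrary
continuous homomorphism `ι : U(2,1) →* G(𝔸_K)` (e.g. the archimedean section
`cmArchSection L ι H T hT` of a CM unitary group `U(H)`, signature `(2,1)` at one place), read as
the archimedean component of the (archimedean-only) automorphy datum `(u21Group, ι)`.

* `analyticAt_rightRegular_toLp_of_u21_null` — let `W` be a complex space of functions on
  `G(𝔸_K)` which are smooth along `ι` (`IsArchSmooth ι`), stable under the Lie derivatives
  `lieDeriv ι X`, `X ∈ 𝔲(2,1)`, represented by `ℒ²(μ)`-functions (`invQuot f`) with injective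
  class map; let `V ≤ W` be finite-dimensional, stable under `lieDeriv ι Y` for `Y ∈ 𝔨`
  (`u21Group.compactLie`), and `𝔭^∓`-null: `X_{ib} ψ = c • X_b ψ` on `V` for a fixed `c` with
  `c² = -1` (`c = i`: the Cauchy–Riemann relations of holomorphic functions on the ball in the
  form of `UnitaryBallLieDerivative`, i.e. annihilation by `𝔭⁻ = {X_b + i X_{ib}}`; `c = -i`:
  antiholomorphic). Then for `f ∈ ℒ²(μ)` with `invQuot f ∈ V`, every `X ∈ 𝔲(2,1)` and every `t₀`,
  the orbit `t ↦ R(ι(exp tX)) [f]` is real analytic at `t₀` as a map into `L²(μ)`.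
* `analyticAt_inner_rightRegular_toLp_of_u21_null` — the matrix-coefficient form
  `t ↦ ⟪u, R(ι(exp tX)) [f]⟫` (the hypothesis `hana` of
  `closure_l2OfForms_exp_invariant_of_analytic` for the datum `(u21Group, ι)`).
* `analyticAt_inner_rightRegular_toLp_of_u21_null_of_mem_lieSpan` — the same conclusion for every
  `f` with `invQuot f` in the complex span of the iterated Lie derivatives `X₁ (⋯ (Xₙ ψ))`,
  `Xᵢ ∈ 𝔲(2,1)`, `ψ ∈ V` (the `𝔤`-stable space `W'` generated by `V`, to which Harish-Chandra's
  closure theorem is applied: this is its hypothesis `hana` for the datum `(u21Group, ι)`), via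
  `AutomorphicAnalyticVectorsSpan`.
* `analyticAt_inner_rightRegular_toLp_of_u21_kStable_of_CR` (and `…_of_mem_lieSpan`) — the same
  with the hypotheses in group form: `V` stable under the right `K_∞`-translates (`K_∞ = U(2,1) ∩ U(3)`;
  `KFiniteLieStable.lieDeriv_mem_of_k_stable` gives `𝔨`-stability) and the Cauchy–Riemann
  relations pointwise, `X_b ψ (g) + i · X_{ib} ψ (g) = 0`.

Proof: `Δ = ∑_𝔨 Y_a² + ∑_b (X_b² + X_{ib}²)` preserves `V` because
`X_b² + X_{ib}² = -c ⁅X_b, X_{ib}⁆` on `V` and `⁅X_b, X_{ib}⁆ ∈ 𝔨`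
(`IsL2LieStable.analyticAt_rightRegular_toLp_of_null`); the archimedean-only automorphy datum
`(u21Group, ι, ⊥, {⊥}, 0)` is built inside the proofs (its finite-adelic part, levels and height
are never used by the archimedean calculus). Harish-Chandra 1953, Lemma 34 (well-behaved =
analytic vectors; `K`-finite vectors of quasi-simple representations); Nelson 1959, §8; for
holomorphic discrete series vectors Knapp 1986, Ch. VI and VIII.

No definition, no `sorry`.

## References

* Harish-Chandra, *Representations of a semisimple Lie group on a Banach space. I*, Trans. AMS 75
  (1953), Lemma 34 (p. 228), §7 Thm. 2 [HarishChandraTAMS1953] (held).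
* E. Nelson, *Analytic vectors*, Ann. of Math. 70 (1959), §8 [Nelson1959].
* A. W. Knapp, *Representation Theory of Semisimple Groups* (1986), Ch. VI, VIII [Knapp1986].
* A. W. Knapp, *Lie Groups Beyond an Introduction* (2002), VI.§2, VII.§9 [Knapp2002].
-/

-- Mathlib idiom (Mathlib/Algebra/Lie/OfAssociative.lean, where `LieRing.ofAssociativeRing` is a `def` made a
-- local instance file by file); needed to mention the Lie algebra `u21Group.lie ≤ 𝔤𝔩₃(ℂ)`
attribute [local instance 100] LieRing.ofAssociativeRing

open scoped MatrixGroups Matrix Topology InnerProductSpace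
open _root_.MeasureTheory
open Literature.AlgebraicGeometry.ShimuraVarieties.BallForms (u21Group liePMat exists_compactLie_frame)
open Literature.Geometry.ComplexHyperbolic.BallModel (U21)

noncomputable section

namespace Literature.NumberTheory.Automorphic

variable {K : Type} [Field K] [NumberField K] {𝒢 : AdelicGroupData K}
  {μ : Measure 𝒢.automorphicQuotient} [𝒢.IsAutomorphicMeasure μ]

/-- **Holomorphic (`𝔭^∓`-null) `𝔨`-finite vectors on `U(2,1)` have analytic `L²`-orbits.** For a
continuous `ι : U(2,1) →* G(𝔸_K)`, an automorphic measure `μ`, an `L²`-Lie-stable space `W` of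
functions smooth along `ι` (stable under `lieDeriv ι X`, represented by `ℒ²(μ)`, injective class
map), and a finite-dimensional `V ≤ W` stable under `lieDeriv ι Y` (`Y ∈ 𝔨 = 𝔲(2,1) ∩ 𝔲(3)`)
with `X_{ib} ψ = c • X_b ψ` on `V` (`c² = -1`), the orbit `t ↦ R(ι(exp tX)) [f]` of the class of
any `f ∈ ℒ²(μ)` with `invQuot f ∈ V` is real analytic at every `t₀`, for every `X ∈ 𝔲(2,1)`.
Harish-Chandra 1953, Lemma 34; Nelson 1959, §8. [cite: HarishChandraTAMS1953, Lemma 34 (p. 228)] -/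
theorem analyticAt_rightRegular_toLp_of_u21_null (ι : U21 →* 𝒢.Adelic) (hι : Continuous ι)
    {W : Submodule ℂ (𝒢.Adelic → ℂ)}
    (hsm : ∀ φ ∈ W, IsArchSmooth (H := u21Group) ι φ)
    (hlie : ∀ X : u21Group.lie, ∀ φ ∈ W, lieDeriv ι X φ ∈ W)
    (hrep : W ≤ 𝒢.l2Representable μ)
    (hinj : ∀ (φ : 𝒢.Adelic → ℂ) (hφ : φ ∈ W), 𝒢.l2ClassOf μ ⟨φ, hrep hφ⟩ = 0 → φ = 0)
    (V : Submodule ℂ (𝒢.Adelic → ℂ)) [FiniteDimensional ℂ V] (hVW : V ≤ W)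
    (hVK : ∀ Y : u21Group.lie, (Y : Matrix (Fin 3) (Fin 3) ℂ) ∈ u21Group.compactLie →
      ∀ ψ ∈ V, lieDeriv ι Y ψ ∈ V)
    (c : ℂ) (hc : c * c = -1)
    (hnull : ∀ ψ ∈ V, ∀ b : Fin 2 → ℂ,
      lieDeriv ι (liePMat (Complex.I • b)) ψ = c • lieDeriv ι (liePMat b) ψ)
    {f : 𝒢.automorphicQuotient → ℂ} (hf : MemLp f 2 μ) (hfV : invQuot 𝒢 f ∈ V)
    (X : u21Group.lie) (t₀ : ℝ) :
    AnalyticAt ℝ (fun t : ℝ ↦ 𝒢.rightRegular μ (ι (u21Group.expMem (t • X))) (hf.toLp f)) t₀ := by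
  -- the archimedean-only automorphy datum attached to `ι` (finite part, levels, height unused)
  let 𝒟 : AutomorphyDatum 𝒢 ℂ (Fin 3) :=
    { arch := u21Group
      ofArch := ι
      continuous_ofArch := hι
      finiteAdelic := ⊥
      commute_ofArch := fun g h hh ↦ by
        rw [Subgroup.mem_bot] at hh
        rw [hh, mul_one, one_mul]
      finiteLevels := {⊥}
      finiteLevels_nonempty := ⟨⊥, rfl⟩
      le_finiteAdelic := fun U hU ↦ by
        rw [Set.mem_singleton_iff] at hU
        rw [hU]
      height := 0 }
  have h : IsL2LieStable 𝒟 μ W := ⟨hsm, hlie, hrep, hinj⟩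
  obtain ⟨n, Y, hYmem, -, hspan, hPQ⟩ := exists_compactLie_frame
  exact h.analyticAt_rightRegular_toLp_of_null Y (fun j : Fin 2 ↦ liePMat (Pi.single j 1))
    (fun j : Fin 2 ↦ liePMat (Complex.I • Pi.single j 1)) hspan (fun j ↦ hPQ _ _) V hVW
    (fun a ψ hψ ↦ hVK (Y a) (hYmem a) ψ hψ) c hc (fun j ψ hψ ↦ hnull ψ hψ (Pi.single j 1))
    hf hfV X t₀

/-- Matrix-coefficient form of `analyticAt_rightRegular_toLp_of_u21_null`: under the same
hypotheses `t ↦ ⟪u, R(ι(exp tX)) [f]⟫` is real analytic at every `t₀`, for every `u ∈ L²(μ)`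
(the input `hana` of `closure_l2OfForms_exp_invariant_of_analytic` for the datum `(u21Group, ι)`).
[cite: HarishChandraTAMS1953, Lemma 34 (p. 228)] -/
theorem analyticAt_inner_rightRegular_toLp_of_u21_null (ι : U21 →* 𝒢.Adelic) (hι : Continuous ι)
    {W : Submodule ℂ (𝒢.Adelic → ℂ)}
    (hsm : ∀ φ ∈ W, IsArchSmooth (H := u21Group) ι φ)
    (hlie : ∀ X : u21Group.lie, ∀ φ ∈ W, lieDeriv ι X φ ∈ W)
    (hrep : W ≤ 𝒢.l2Representable μ)
    (hinj : ∀ (φ : 𝒢.Adelic → ℂ) (hφ : φ ∈ W), 𝒢.l2ClassOf μ ⟨φ, hrep hφ⟩ = 0 → φ = 0)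
    (V : Submodule ℂ (𝒢.Adelic → ℂ)) [FiniteDimensional ℂ V] (hVW : V ≤ W)
    (hVK : ∀ Y : u21Group.lie, (Y : Matrix (Fin 3) (Fin 3) ℂ) ∈ u21Group.compactLie →
      ∀ ψ ∈ V, lieDeriv ι Y ψ ∈ V)
    (c : ℂ) (hc : c * c = -1)
    (hnull : ∀ ψ ∈ V, ∀ b : Fin 2 → ℂ,
      lieDeriv ι (liePMat (Complex.I • b)) ψ = c • lieDeriv ι (liePMat b) ψ)
    {f : 𝒢.automorphicQuotient → ℂ} (hf : MemLp f 2 μ) (hfV : invQuot 𝒢 f ∈ V)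
    (X : u21Group.lie) (u : 𝒢.L2 μ) (t₀ : ℝ) :
    AnalyticAt ℝ (fun t : ℝ ↦
      ⟪u, 𝒢.rightRegular μ (ι (u21Group.expMem (t • X))) (hf.toLp f)⟫_ℂ) t₀ := by
  have han := analyticAt_rightRegular_toLp_of_u21_null ι hι hsm hlie hrep hinj V hVW hVK c hc hnull
    hf hfV X t₀
  have h2 := (((innerSL ℂ u).restrictScalars ℝ).analyticAt _).comp han
  simpa only [Function.comp_def, ContinuousLinearMap.coe_restrictScalars', innerSL_apply_apply] using h2


/-- **The `U(𝔤)`-span version** (input `hana` of the closure theorem). Hypotheses as in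
`analyticAt_rightRegular_toLp_of_u21_null`; conclusion for every `f ∈ ℒ²(μ)` whose inversion
`invQuot f` lies in the complex span of the iterated Lie derivatives `X₁ (X₂ (⋯ (Xₙ ψ)))`,
`Xᵢ ∈ 𝔲(2,1)`, `ψ ∈ V`: the coefficient `t ↦ ⟪u, R(ι(exp tX)) [f]⟫` is real analytic at every
`t₀`. Harish-Chandra 1953, §7 and Lemma 34; Nelson 1959, §8. [cite: HarishChandraTAMS1953, Lemma 34 (p. 228)] -/
theorem analyticAt_inner_rightRegular_toLp_of_u21_null_of_mem_lieSpan (ι : U21 →* 𝒢.Adelic)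
    (hι : Continuous ι) {W : Submodule ℂ (𝒢.Adelic → ℂ)}
    (hsm : ∀ φ ∈ W, IsArchSmooth (H := u21Group) ι φ)
    (hlie : ∀ X : u21Group.lie, ∀ φ ∈ W, lieDeriv ι X φ ∈ W)
    (hrep : W ≤ 𝒢.l2Representable μ)
    (hinj : ∀ (φ : 𝒢.Adelic → ℂ) (hφ : φ ∈ W), 𝒢.l2ClassOf μ ⟨φ, hrep hφ⟩ = 0 → φ = 0)
    (V : Submodule ℂ (𝒢.Adelic → ℂ)) [FiniteDimensional ℂ V] (hVW : V ≤ W)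
    (hVK : ∀ Y : u21Group.lie, (Y : Matrix (Fin 3) (Fin 3) ℂ) ∈ u21Group.compactLie →
      ∀ ψ ∈ V, lieDeriv ι Y ψ ∈ V)
    (c : ℂ) (hc : c * c = -1)
    (hnull : ∀ ψ ∈ V, ∀ b : Fin 2 → ℂ,
      lieDeriv ι (liePMat (Complex.I • b)) ψ = c • lieDeriv ι (liePMat b) ψ)
    {φ : 𝒢.Adelic → ℂ}
    (hφ : φ ∈ Submodule.span ℂ {χ | ∃ (l : List u21Group.lie) (ψ : 𝒢.Adelic → ℂ), ψ ∈ V ∧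
      χ = iterLieDeriv ι l ψ})
    {f : 𝒢.automorphicQuotient → ℂ} (hf : MemLp f 2 μ) (hfφ : invQuot 𝒢 f = φ)
    (X : u21Group.lie) (u : 𝒢.L2 μ) (t₀ : ℝ) :
    AnalyticAt ℝ (fun t : ℝ ↦
      ⟪u, 𝒢.rightRegular μ (ι (u21Group.expMem (t • X))) (hf.toLp f)⟫_ℂ) t₀ := by
  let 𝒟 : AutomorphyDatum 𝒢 ℂ (Fin 3) :=
    { arch := u21Group
      ofArch := ι
      continuous_ofArch := hι
      finiteAdelic := ⊥
      commute_ofArch := fun g h hh ↦ by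
        rw [Subgroup.mem_bot] at hh
        rw [hh, mul_one, one_mul]
      finiteLevels := {⊥}
      finiteLevels_nonempty := ⟨⊥, rfl⟩
      le_finiteAdelic := fun U hU ↦ by
        rw [Set.mem_singleton_iff] at hU
        rw [hU]
      height := 0 }
  have h : IsL2LieStable 𝒟 μ W := ⟨hsm, hlie, hrep, hinj⟩
  obtain ⟨n, Y, hYmem, -, hspan, hPQ⟩ := exists_compactLie_frame
  exact h.analyticAt_inner_rightRegular_toLp_of_mem_lieSpan_of_null Y
    (fun j : Fin 2 ↦ liePMat (Pi.single j 1)) (fun j : Fin 2 ↦ liePMat (Complex.I • Pi.single j 1))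
    hspan (fun j ↦ hPQ _ _) V hVW (fun a ψ hψ ↦ hVK (Y a) (hYmem a) ψ hψ) c hc
    (fun j ψ hψ ↦ hnull ψ hψ (Pi.single j 1)) hφ hf hfφ X u t₀

/-- Pointwise Cauchy–Riemann relations `X_b ψ + i X_{ib} ψ = 0` give `X_{ib} ψ = i • X_b ψ`.
[cite: Knapp1986, Ch. VI §4] -/
theorem lieDeriv_liePMat_I_smul_eq_of_CR {G : Type*} [Group G] (ι : U21 →* G) {ψ : G → ℂ}
    {b : Fin 2 → ℂ}
    (hCR : ∀ g : G, lieDeriv ι (liePMat b) ψ g + Complex.I * lieDeriv ι (liePMat (Complex.I • b)) ψ g = 0) :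
    lieDeriv ι (liePMat (Complex.I • b)) ψ = Complex.I • lieDeriv ι (liePMat b) ψ := by
  funext g
  have h := hCR g
  rw [Pi.smul_apply, smul_eq_mul]
  have e : lieDeriv ι (liePMat (Complex.I • b)) ψ g =
      -Complex.I * (lieDeriv ι (liePMat b) ψ g + Complex.I * lieDeriv ι (liePMat (Complex.I • b)) ψ g) +
        Complex.I * lieDeriv ι (liePMat b) ψ g := by
    ring_nf
    rw [Complex.I_sq]
    ring
  rw [e, h, mul_zero, zero_add]

/-- **The group-level / pointwise form for holomorphic vectors.** As
`analyticAt_inner_rightRegular_toLp_of_u21_null`, with `V` assumed stable under the right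
translates `r(k)`, `k ∈ K_∞ = U(2,1) ∩ U(3)` (whence `𝔨`-stable,
`KFiniteLieStable.lieDeriv_mem_of_k_stable`), and the Cauchy–Riemann relations of
`UnitaryBallLieDerivative` pointwise: `X_b ψ (g) + i · X_{ib} ψ (g) = 0` for `ψ ∈ V`
(annihilation by `𝔭⁻`). Conclusion: `t ↦ ⟪u, R(ι(exp tX)) [f]⟫` is real analytic at every `t₀`.
Harish-Chandra 1953, Lemma 34; Knapp 1986, Ch. VIII §3. [cite: HarishChandraTAMS1953, Lemma 34 (p. 228)] -/
theorem analyticAt_inner_rightRegular_toLp_of_u21_kStable_of_CR (ι : U21 →* 𝒢.Adelic)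
    (hι : Continuous ι) {W : Submodule ℂ (𝒢.Adelic → ℂ)}
    (hsm : ∀ φ ∈ W, IsArchSmooth (H := u21Group) ι φ)
    (hlie : ∀ X : u21Group.lie, ∀ φ ∈ W, lieDeriv ι X φ ∈ W)
    (hrep : W ≤ 𝒢.l2Representable μ)
    (hinj : ∀ (φ : 𝒢.Adelic → ℂ) (hφ : φ ∈ W), 𝒢.l2ClassOf μ ⟨φ, hrep hφ⟩ = 0 → φ = 0)
    (V : Submodule ℂ (𝒢.Adelic → ℂ)) [FiniteDimensional ℂ V] (hVW : V ≤ W)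
    (hVK : ∀ k : u21Group.maximalCompact, ∀ ψ ∈ V,
      archTranslate ι (Subgroup.inclusion u21Group.maximalCompact_le_carrier k) ψ ∈ V)
    (hCR : ∀ ψ ∈ V, ∀ (b : Fin 2 → ℂ) (g : 𝒢.Adelic),
      lieDeriv ι (liePMat b) ψ g + Complex.I * lieDeriv ι (liePMat (Complex.I • b)) ψ g = 0)
    {f : 𝒢.automorphicQuotient → ℂ} (hf : MemLp f 2 μ) (hfV : invQuot 𝒢 f ∈ V)
    (X : u21Group.lie) (u : 𝒢.L2 μ) (t₀ : ℝ) :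
    AnalyticAt ℝ (fun t : ℝ ↦
      ⟪u, 𝒢.rightRegular μ (ι (u21Group.expMem (t • X))) (hf.toLp f)⟫_ℂ) t₀ := by
  have hVsm : ∀ ψ ∈ V, IsArchSmooth (H := u21Group) ι ψ := fun ψ hψ ↦ hsm ψ (hVW hψ)
  refine analyticAt_inner_rightRegular_toLp_of_u21_null ι hι hsm hlie hrep hinj V hVW
    (fun Y hY _ hψ ↦ lieDeriv_mem_of_k_stable ι hVK hVsm Y hY hψ) Complex.I Complex.I_mul_I
    (fun ψ hψ b ↦ lieDeriv_liePMat_I_smul_eq_of_CR ι (hCR ψ hψ b)) hf hfV X u t₀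

/-- **Group-level / pointwise form, `U(𝔤)`-span version**: `V` stable under the right
`K_∞`-translates, Cauchy–Riemann relations pointwise on `V`; conclusion for every `f ∈ ℒ²(μ)`
with `invQuot f` in the complex span of the iterated Lie derivatives of elements of `V`:
`t ↦ ⟪u, R(ι(exp tX)) [f]⟫` is real analytic at every `t₀`. This is the hypothesis `hana` of
`closure_l2OfForms_exp_invariant_of_analytic_of_memLp` for the `𝔤`-stable space generated by the
`K_∞`-span of a holomorphic vector. [cite: HarishChandraTAMS1953, Lemma 34 (p. 228)] -/
theorem analyticAt_inner_rightRegular_toLp_of_u21_kStable_of_CR_of_mem_lieSpan (ι : U21 →* 𝒢.Adelic)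
    (hι : Continuous ι) {W : Submodule ℂ (𝒢.Adelic → ℂ)}
    (hsm : ∀ φ ∈ W, IsArchSmooth (H := u21Group) ι φ)
    (hlie : ∀ X : u21Group.lie, ∀ φ ∈ W, lieDeriv ι X φ ∈ W)
    (hrep : W ≤ 𝒢.l2Representable μ)
    (hinj : ∀ (φ : 𝒢.Adelic → ℂ) (hφ : φ ∈ W), 𝒢.l2ClassOf μ ⟨φ, hrep hφ⟩ = 0 → φ = 0)
    (V : Submodule ℂ (𝒢.Adelic → ℂ)) [FiniteDimensional ℂ V] (hVW : V ≤ W)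
    (hVK : ∀ k : u21Group.maximalCompact, ∀ ψ ∈ V,
      archTranslate ι (Subgroup.inclusion u21Group.maximalCompact_le_carrier k) ψ ∈ V)
    (hCR : ∀ ψ ∈ V, ∀ (b : Fin 2 → ℂ) (g : 𝒢.Adelic),
      lieDeriv ι (liePMat b) ψ g + Complex.I * lieDeriv ι (liePMat (Complex.I • b)) ψ g = 0)
    {φ : 𝒢.Adelic → ℂ}
    (hφ : φ ∈ Submodule.span ℂ {χ | ∃ (l : List u21Group.lie) (ψ : 𝒢.Adelic → ℂ), ψ ∈ V ∧
      χ = iterLieDeriv ι l ψ})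
    {f : 𝒢.automorphicQuotient → ℂ} (hf : MemLp f 2 μ) (hfφ : invQuot 𝒢 f = φ)
    (X : u21Group.lie) (u : 𝒢.L2 μ) (t₀ : ℝ) :
    AnalyticAt ℝ (fun t : ℝ ↦
      ⟪u, 𝒢.rightRegular μ (ι (u21Group.expMem (t • X))) (hf.toLp f)⟫_ℂ) t₀ :=
  have hVsm : ∀ ψ ∈ V, IsArchSmooth (H := u21Group) ι ψ := fun ψ hψ ↦ hsm ψ (hVW hψ)
  analyticAt_inner_rightRegular_toLp_of_u21_null_of_mem_lieSpan ι hι hsm hlie hrep hinj V hVW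
    (fun Y hY _ hψ ↦ lieDeriv_mem_of_k_stable ι hVK hVsm Y hY hψ) Complex.I Complex.I_mul_I
    (fun ψ hψ b ↦ lieDeriv_liePMat_I_smul_eq_of_CR ι (hCR ψ hψ b)) hφ hf hfφ X u t₀

end Literature.NumberTheory.Automorphic
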